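import Summits.QuantumFields.YangMills.Theorems.UnitScaleTiltFluctuationComparisonRegPrGlobalSlackLegCfgDistNaturalRows
import Summits.QuantumFields.YangMills.Theorems.UnitScaleTiltFluctuationComparisonRegPrGlobalSlackLegOldTermsKernelFormAnalytic
import Summits.QuantumFields.YangMills.Theorems.UnitScaleTiltFluctuationComparisonRegPrGlobalSlackLegCfgDistNaturalT3Gamma
import Summits.QuantumFields.YangMills.Theorems.UnitScaleTiltFluctuationComparisonRegPrGlobalSlackKernelLegDisplayProfileLowV4
import HarnessLib

/-!
# `UnitScaleTiltFluctuationComparisonRegPrGlobalSlackLegCfgDistNaturalRowsDoor` — (R4), THE I-11 ROW `CfgDistΦ` AND THE DOOR DISPLAYS `K1aLegRowsDisplayChiAtLowV4` FOR THE NATURAL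
# CONFIGURATION FAMILY `B♮ᴿ` OVER THE v4 χ-PACKAGE OF THE LINE OF RECORD v5kD (crux `FluctuationComparisonRegPrIntL`, stmt-QuantumFields-20520, STUB 3⁗χ(v4) `stub_globalTwoRunSlackFamChiV4`;
# cell `pub/ym-inputs`, seat ym-inputs-p11 (g2); count-neutral helper, def-free, registry untouched)

WHY.  `…LegCfgDistNaturalRows` (this seat) states the natural family `B♮ᴿ := B♮[birthCfgAtRows q, fun K ↦ (q K).UkH]` over a rows record `q : ∀ K, PkgCoreRows …` and proves (R4-low),
(N)'s configuration clause and the exactness record-light.  This sequel supplies, at the v4 χ-package `p : ∀ K, PkgAtV4Chi …` (`q := fun K ↦ (p K).toRows`, datum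
`dataOfV4chi p (canonPolymerRows q)`) and in the letters of ym-ust-20520-w2 g4's v4 display chain (`NewLevelIsBirthRows`, `cfgDistOwnΦ_chiV4_of_low_of_newLevelIsBirth`,
`K1aLegRowsDisplayChiAtLowV4`), the v4 twins of ✓p621414 §3 / ✓p621894 / ✓p622807:

* §1 at the v4 χ-package: **`cfgDistOwnΦ_chiV4_natural`** — (R4) at every `p₁ ≥ p₀ + r₀`, constant `max (24LB₃) (cB·(√L)⁻¹(1+log √L)^{p₁})`; ★ **`cfgDistΦ_chiV4_natural`** — THE I-11 ROW (44)
  `CfgDistΦ (dataOfV4chi p (canonPolymerRows q)) B♮ᴿ (canonLegDist F) 𝔠.b₀ p₁ (…)` for both runs (`cfgDistΦ_of_own`, `locMatched_canonRows`, `canonLegDist_matched`);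
  **`cfgDistΦ_chiV4_natural_of_le_gammaθ`** — the same below the explicit coupling threshold `γ ≤ gammaθ b₀ p₁ σ♮` (✓`windowLetters_of_le_gammaθ`).
* §2 ★ **`k1aLegRowsDisplayChiAtLowV4_of_naturalRows`** — THE DOOR: if, with constants `κ′ ρ C C_A C_B γB`, for every `F` (`F.L = L`), `γ ≤ γB`, there are a height-free `Ψ` and a
  coherent `BR` such that every coherent v4 χ-package admits charts `Φ` and vacuum constants `e` with (R1) `KernelRefOwnΦ … Φ Ψ …`, (R2′) `ChartAnalyticΦ … (rescaleΦw … Φ) …`, the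
  new-level clauses `Φ = birthChartRows q`, `e = 0` on the retained domains, (M1) `OldTermsAreJetsOwnRows q Φ e B♮ᴿ` and (R5) `CfgRefOwnΦ … B♮ᴿ BR …`, then
  `K1aLegRowsDisplayChiAtLowV4 L 𝔠 a₀ a₁ a p₁` holds with `C_s := 24·L·B₃` and threshold `min γB (gammaθ b₀ p₁ σ♮)` — ✓p622807's proof with `Core ↦ Rows`.
* §3 ★★ **`k1aLegRowsDisplayChiAtLowV4_of_kernelRows`** — THE DOOR WITH (N) AND (M1) DISCHARGED at the natural chart family `Φ♮[birthChartRows q, N]` of `…LegOldTermsKernelForm`: the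
  display from `L < M₁`, PRINT'S (43) KERNEL ROW on the record's `oldTermRows`, (R1)[Φ♮], (R2′)[Φ♮], (R5)[B♮ᴿ] — what is left is
  two cross-cut-off rows (unprinted for non-abelian d = 3) and one analyticity row whose old-block clause is a leg-weighted kernel budget.

HONEST SCOPE.  The v4 twins of landed bookkeeping; no new estimate; (M1) (the content: the record's `oldVal` are jets at `B♮ᴿ`), (R1), (R2′), (R5) stay HYPOTHESES — displays of the
(α)-record desk (NODE-O / B0); nothing of [Balaban1985UV3] / [King1986] asserted; no summit / rung / gap claim (YM₃ on T³ is ladder rung R3, not the Clay problem).  L-floor: none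
beyond `1 < L` (every `T3Family`).

References: T. Bałaban, CMP 102 (1985) 255–275 [Balaban1985UV3] ((7) p.257, (27)–(28) p.263, (43)–(45) pp.266–267, (60)–(61) p.271); C. King, CMP 102 (1986) 649–677 [King1986]
(Thm 3.4 (3.9) p.656, Prop. 3.6 (3.56) p.662, Prop. 3.9 (3.71)–(3.74) p.665); CMP 109 (1987) 249–301 [Balaban1987RG1] ((0.1) p.251).
-/

set_option autoImplicit false

noncomputable section

open scoped Matrix.Norms.L2Operator Nat
open Literature.MathematicalPhysics.QuantumFieldTheory.Balaban1983to89
open Literature.MathematicalPhysics.QuantumFieldTheory.Balaban1983to89.T3ContinuumYM3Torus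
open Literature.MathematicalPhysics.QuantumFieldTheory.Balaban1983to89.T3UnitLawDensityEML (ℰp)
open Literature.MathematicalPhysics.QuantumFieldTheory.Balaban1983to89.T3UnitScaleTilt (θBal)
open Literature.MathematicalPhysics.QuantumFieldTheory.Balaban1983to89.T3LevelShift (fieldShift)
open Literature.MathematicalPhysics.QuantumFieldTheory.Balaban1983to89.T3AlphaInputsAC (AlphaDataT3)
open Literature.MathematicalPhysics.QuantumFieldTheory.Balaban1983to89.TreeLengthTorus (tsys)
open Literature.MathematicalPhysics.QuantumFieldTheory.Balaban1983to89.B10Eq27TorusAxialLog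
open Literature.MathematicalPhysics.QuantumFieldTheory.Balaban1983to89.B7Prop1Explicit (l1)
open Literature.MathematicalPhysics.QuantumFieldTheory.Balaban1983to89.ExpMeanLog (deltaSU deltaSU_pos)
open Literature.MathematicalPhysics.QuantumFieldTheory.Balaban1985CMP102
open Literature.MathematicalPhysics.QuantumFieldTheory.Balaban1985CMP102.Setting
open Summit.QuantumFields.Balaban3D.Carriers
open Summit.QuantumFields.Balaban3D.Proofs.Primitives
open Summit.QuantumFields.Balaban3D.Proofs.GroupModelLieC (vecE lieC)
open Summit.QuantumFields.YangMills.Theorems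
open Summit.QuantumFields.YangMills.Theorems.GlobalSlackKernelMatching
open Summit.QuantumFields.YangMills.Theorems.GlobalSlackCanonicalPolymers

namespace Summit.QuantumFields.YangMills.Theorems.GlobalSlackKernelLeg

variable {F : T3Family} {𝔠 : AlphaConsts F.L (suGroupModel 2).N} {γ : ℝ} {hγ : 0 < γ} {hγ1 : γ ≤ (min 𝔠.gamma0 1) ^ 2}

/-! ## §1 (R4), the I-11 row `CfgDistΦ` and its threshold form at the v4 χ-package -/

section ChiV4

open Classical in
/-- **(R4) `CfgDistOwnΦ` FOR `B♮ᴿ` AT THE v4 χ-PACKAGE AND EVERY PROFILE `p₁ ≥ p₀ + r₀`** (w2's `cfgDistOwnΦ_chiV4_of_low_of_newLevelIsBirth` on (R4-low) ✓`cfgDistOwnΦLow_naturalRows` and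
(N) `newLevelIsBirthRows_naturalRows` at `q := fun K ↦ (p K).toRows`): constant `max (24·L·B₃) (cB·(√L)⁻¹(1 + log √L)^{p₁})`, window letters `hθ` at the package's own `a₀`, `a₁`.
[cite: Balaban1985UV3, (27)-(28) p.263, (44) p.267; Balaban1985Variational, Thm 1 (8) p.279; Balaban1985Averaging, Prop. 2 (54) p.26] -/
theorem cfgDistOwnΦ_chiV4_natural (p : ∀ K, AlphaInputsT3AC.PkgAtV4Chi F 𝔠 γ hγ hγ1 K) {p₁ : ℝ} (hp : 𝔠.p₀ + 𝔠.r₀ ≤ p₁)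
    (hθ : ∀ K n, n < K →
      θBal F.L γ 𝔠.b₀ p₁ n ≤ (p K).a₁ ∧ 𝔠.B₃ * θBal F.L γ 𝔠.b₀ p₁ n ≤ (p K).a₀ ∧
      (143 * ((((3 + 4 : ℕ) : ℝ)) ^ 2 / 4) ^ 2) * (𝔠.B₃ * θBal F.L γ 𝔠.b₀ p₁ n) ≤ 1 / 3 ∧
      2 * (𝔠.B₃ * θBal F.L γ 𝔠.b₀ p₁ n) ≤ 2 * deltaSU (Fin 2) / (((3 + 4) * F.L : ℕ) : ℝ) ^ 2) :
    CfgDistOwnΦ (AlphaInputsT3AC.dataOfV4chi p (canonPolymerRows fun K => (p K).toRows))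
      (fun K k b Y W c =>
        if h : b + 1 = k then birthCfgAtRows (fun K => (p K).toRows) K b Y (h ▸ W) c
        else if (l1 (rel (anchors_nonempty (F := F) K b Y).choose c.src) : ℝ) *
            (2 * (𝔠.B₃ * θBal F.L γ 𝔠.b₀ p₁ (K - k)) * (((F.L : ℝ) ^ (k - b))⁻¹) ^ 2) ≤ 1 / 2 then
          (lieC (suGroupModel 2)).orthogonalProjectionOnto
            (vecE (suGroupModel 2).N
              (B27T (unitsField (toUField (Averaging.iter (fun i => BlockAveraging.blockAvg (P := F.P K) (j := i) ℰp) b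
                ((p K).UkH k (Hist.triv (F.P K) k) W)))) (anchors_nonempty (F := F) K b Y).choose c))
        else 0)
      (canonLegDist F) 𝔠.b₀ p₁ (max (24 * F.L * 𝔠.B₃) (𝔠.cB * ((Real.sqrt F.L)⁻¹ * (1 + Real.log (Real.sqrt F.L)) ^ p₁))) :=
  cfgDistOwnΦ_chiV4_of_low_of_newLevelIsBirth p hp (by have := 𝔠.B₃_pos; have := F.hL.2; positivity)
    (newLevelIsBirthRows_naturalRows fun K => (p K).toRows) (cfgDistOwnΦLow_naturalRows (fun K => (p K).toRows) hθ)

open Classical in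
/-- ★ **THE I-11 ROW (44) `CfgDistΦ` HOLDS FOR THE NATURAL FAMILY `B♮ᴿ` AT THE v4 χ-PACKAGE** (both runs, canonical leg distance, every profile `p₁ ≥ p₀ + r₀`, under the window letters
`hθ`): `cfgDistΦ_of_own` on (R4) (`locMatched_canonRows`, `canonLegDist_matched`). [cite: Balaban1985UV3, (44) p.267; Balaban1987RG1, (0.1) p.251] -/
theorem cfgDistΦ_chiV4_natural (p : ∀ K, AlphaInputsT3AC.PkgAtV4Chi F 𝔠 γ hγ hγ1 K) {p₁ : ℝ} (hp : 𝔠.p₀ + 𝔠.r₀ ≤ p₁)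
    (hθ : ∀ K n, n < K →
      θBal F.L γ 𝔠.b₀ p₁ n ≤ (p K).a₁ ∧ 𝔠.B₃ * θBal F.L γ 𝔠.b₀ p₁ n ≤ (p K).a₀ ∧
      (143 * ((((3 + 4 : ℕ) : ℝ)) ^ 2 / 4) ^ 2) * (𝔠.B₃ * θBal F.L γ 𝔠.b₀ p₁ n) ≤ 1 / 3 ∧
      2 * (𝔠.B₃ * θBal F.L γ 𝔠.b₀ p₁ n) ≤ 2 * deltaSU (Fin 2) / (((3 + 4) * F.L : ℕ) : ℝ) ^ 2) :
    CfgDistΦ (AlphaInputsT3AC.dataOfV4chi p (canonPolymerRows fun K => (p K).toRows))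
      (fun K k b Y W c =>
        if h : b + 1 = k then birthCfgAtRows (fun K => (p K).toRows) K b Y (h ▸ W) c
        else if (l1 (rel (anchors_nonempty (F := F) K b Y).choose c.src) : ℝ) *
            (2 * (𝔠.B₃ * θBal F.L γ 𝔠.b₀ p₁ (K - k)) * (((F.L : ℝ) ^ (k - b))⁻¹) ^ 2) ≤ 1 / 2 then
          (lieC (suGroupModel 2)).orthogonalProjectionOnto
            (vecE (suGroupModel 2).N
              (B27T (unitsField (toUField (Averaging.iter (fun i => BlockAveraging.blockAvg (P := F.P K) (j := i) ℰp) b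
                ((p K).UkH k (Hist.triv (F.P K) k) W)))) (anchors_nonempty (F := F) K b Y).choose c))
        else 0)
      (canonLegDist F) 𝔠.b₀ p₁ (max (24 * F.L * 𝔠.B₃) (𝔠.cB * ((Real.sqrt F.L)⁻¹ * (1 + Real.log (Real.sqrt F.L)) ^ p₁))) :=
  cfgDistΦ_of_own (locMatched_canonRows fun K => (p K).toRows) (canonLegDist_matched F) (cfgDistOwnΦ_chiV4_natural p hp hθ)

open Classical in
/-- **THE I-11 ROW `CfgDistΦ` FOR `B♮ᴿ` AT THE v4 χ-PACKAGE BELOW AN EXPLICIT COUPLING THRESHOLD**: at a coherent package (`(p K).a₀ = a₀`, `(p K).a₁ = a₁`), for every profile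
`p₁ ≥ p₀ + r₀` and every coupling `γ ≤ gammaθ b₀ p₁ σ♮`, `σ♮ = min a₁ (min (a₀/B₃) (min (1/(3·143·(7²/4)²·B₃)) (δ_{SU(2)}/((7L)²·B₃))))` (✓`windowLetters_of_le_gammaθ`).
[cite: Balaban1985UV3, (44) p.267, (27)-(28) p.263, (7) p.257; Balaban1985Variational, Thm 1 (8) p.279; Balaban1985Averaging, Prop. 2 (54) p.26] -/
theorem cfgDistΦ_chiV4_natural_of_le_gammaθ (p : ∀ K, AlphaInputsT3AC.PkgAtV4Chi F 𝔠 γ hγ hγ1 K) {a₀ a₁ p₁ : ℝ} (ha₀ : 0 < a₀) (ha₁ : 0 < a₁)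
    (hp : ∀ K, (p K).a₀ = a₀ ∧ (p K).a₁ = a₁) (hp₁ : 𝔠.p₀ + 𝔠.r₀ ≤ p₁)
    (hγw : γ ≤ gammaθ 𝔠.b₀ p₁ (min a₁ (min (a₀ / 𝔠.B₃) (min (1 / (3 * (143 * ((((3 + 4 : ℕ) : ℝ)) ^ 2 / 4) ^ 2) * 𝔠.B₃))
      (deltaSU (Fin 2) / ((((3 + 4) * F.L : ℕ) : ℝ) ^ 2 * 𝔠.B₃)))))) :
    CfgDistΦ (AlphaInputsT3AC.dataOfV4chi p (canonPolymerRows fun K => (p K).toRows))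
      (fun K k b Y W c =>
        if h : b + 1 = k then birthCfgAtRows (fun K => (p K).toRows) K b Y (h ▸ W) c
        else if (l1 (rel (anchors_nonempty (F := F) K b Y).choose c.src) : ℝ) *
            (2 * (𝔠.B₃ * θBal F.L γ 𝔠.b₀ p₁ (K - k)) * (((F.L : ℝ) ^ (k - b))⁻¹) ^ 2) ≤ 1 / 2 then
          (lieC (suGroupModel 2)).orthogonalProjectionOnto
            (vecE (suGroupModel 2).N
              (B27T (unitsField (toUField (Averaging.iter (fun i => BlockAveraging.blockAvg (P := F.P K) (j := i) ℰp) b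
                ((p K).UkH k (Hist.triv (F.P K) k) W)))) (anchors_nonempty (F := F) K b Y).choose c))
        else 0)
      (canonLegDist F) 𝔠.b₀ p₁ (max (24 * F.L * 𝔠.B₃) (𝔠.cB * ((Real.sqrt F.L)⁻¹ * (1 + Real.log (Real.sqrt F.L)) ^ p₁))) := by
  have hp₁' : 0 < p₁ := by have := 𝔠.p₀_pos; have := 𝔠.one_le_r₀; linarith
  refine cfgDistΦ_chiV4_natural p hp₁ fun K n _ => ?_
  obtain ⟨h1, h2, h3, h4⟩ := windowLetters_of_le_gammaθ (𝔠 := 𝔠) hγ (hγ1.trans (sq_min_one_le _ 𝔠.gamma0_pos)) ha₀ ha₁ hp₁' hγw n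
  rw [(hp K).1, (hp K).2]
  exact ⟨h1, h2, h3, h4⟩

end ChiV4

/-! ## §2 The door display `K1aLegRowsDisplayChiAtLowV4` from its four remaining rows at `B := B♮ᴿ` -/

open Classical in
/-- ★ **THE v4 DOOR DISPLAY FROM ITS FOUR REMAINING ROWS AT `B := B♮ᴿ`**: (R1), (R2′), the new-level chart / vacuum-constant clauses, (M1) and (R5) for the natural family of the
v4 χ-package's rows record, with constants `κ′ ρ C C_A C_B` and a threshold `γB`, give `K1aLegRowsDisplayChiAtLowV4 L 𝔠 a₀ a₁ a p₁` for every `p₁ ≥ p₀ + r₀` (constant `C_s = 24·L·B₃`,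
threshold `min γB (gammaθ b₀ p₁ σ♮)`; (R4-low) and (N)'s configuration clause supplied by ✓`cfgDistOwnΦLow_naturalRows`, ✓`windowLetters_of_le_gammaθ`, ✓`naturalRows_newLevel_eq_bcfg`).
[cite: Balaban1985UV3, (27)-(28) p.263, (43)-(45) pp.266-267, (60)-(61) p.271; King1986, Prop. 3.6 (3.56) p.662, Prop. 3.9 (3.71)-(3.74) p.665] -/
theorem k1aLegRowsDisplayChiAtLowV4_of_naturalRows {L : ℕ} (hL : 1 < L) {𝔠 : AlphaConsts L (suGroupModel 2).N} {a₀ a₁ a p₁ : ℝ} (ha₀ : 0 < a₀) (ha₁ : 0 < a₁)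
    (hp₁ : 𝔠.p₀ + 𝔠.r₀ ≤ p₁)
    (h : ∃ (κ' ρ C C_A C_B γB : ℝ), 0 < κ' ∧ 0 < ρ ∧ 0 ≤ C ∧ 0 ≤ C_A ∧ 0 ≤ C_B ∧ 0 < γB ∧
      ∀ (F : T3Family) (γ : ℝ) (hF : F.L = L) (hγ : 0 < γ), γ ≤ γB → ∀ (hγ1 : γ ≤ (min (hF ▸ 𝔠).gamma0 1) ^ 2),
        ∃ (Ψ : ChartFam ↥(lieC (suGroupModel 2)) F) (BR : CfgFam ↥(lieC (suGroupModel 2)) F), KerHeightFree Ψ ∧ RefCfgCoherent BR ∧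
          (AlphaInputsT3AC.OfV4ChiAt F (hF ▸ 𝔠) a₀ a₁ →
            ∃ (p : ∀ K, AlphaInputsT3AC.PkgAtV4Chi F (hF ▸ 𝔠) γ hγ hγ1 K), (∀ K, (p K).a₀ = a₀ ∧ (p K).a₁ = a₁) ∧
              ∃ (Φ : ChartFam ↥(lieC (suGroupModel 2)) F) (e : VacFam F),
                KernelRefOwnΦ (AlphaInputsT3AC.dataOfV4chi p (canonPolymerRows fun K => (p K).toRows)) Φ Ψ (canonLegDist F) κ' (hF ▸ 𝔠).κ a C ∧
                ChartAnalyticΦ (AlphaInputsT3AC.dataOfV4chi p (canonPolymerRows fun K => (p K).toRows)) (rescaleΦw (canonLegDist F) κ' Φ) (hF ▸ 𝔠).κ ρ C_A ∧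
                (∀ (K k : ℕ), k + 1 ≤ K → ∀ X ∈ newDomsRows (fun K => (p K).toRows) K k (Hist.triv (F.P K) (k + 1)),
                  Φ K k (domSet (F := F) (hF ▸ 𝔠).lane.carrier.M₁ K k X) = birthChartRows (fun K => (p K).toRows) K k (domSet (F := F) (hF ▸ 𝔠).lane.carrier.M₁ K k X) ∧
                  e K k (domSet (F := F) (hF ▸ 𝔠).lane.carrier.M₁ K k X) = 0) ∧
                OldTermsAreJetsOwnRows (fun K => (p K).toRows) Φ e
                  (fun K k b Y W c =>
                    if h : b + 1 = k then birthCfgAtRows (fun K => (p K).toRows) K b Y (h ▸ W) c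
                    else if (l1 (rel (anchors_nonempty (F := F) K b Y).choose c.src) : ℝ) *
                        (2 * ((hF ▸ 𝔠).B₃ * θBal F.L γ (hF ▸ 𝔠).b₀ p₁ (K - k)) * (((F.L : ℝ) ^ (k - b))⁻¹) ^ 2) ≤ 1 / 2 then
                      (lieC (suGroupModel 2)).orthogonalProjectionOnto
                        (vecE (suGroupModel 2).N
                          (B27T (unitsField (toUField (Averaging.iter (fun i => BlockAveraging.blockAvg (P := F.P K) (j := i) ℰp) b
                            ((p K).UkH k (Hist.triv (F.P K) k) W)))) (anchors_nonempty (F := F) K b Y).choose c))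
                    else 0) ∧
                CfgRefOwnΦ (AlphaInputsT3AC.dataOfV4chi p (canonPolymerRows fun K => (p K).toRows))
                  (fun K k b Y W c =>
                    if h : b + 1 = k then birthCfgAtRows (fun K => (p K).toRows) K b Y (h ▸ W) c
                    else if (l1 (rel (anchors_nonempty (F := F) K b Y).choose c.src) : ℝ) *
                        (2 * ((hF ▸ 𝔠).B₃ * θBal F.L γ (hF ▸ 𝔠).b₀ p₁ (K - k)) * (((F.L : ℝ) ^ (k - b))⁻¹) ^ 2) ≤ 1 / 2 then
                      (lieC (suGroupModel 2)).orthogonalProjectionOnto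
                        (vecE (suGroupModel 2).N
                          (B27T (unitsField (toUField (Averaging.iter (fun i => BlockAveraging.blockAvg (P := F.P K) (j := i) ℰp) b
                            ((p K).UkH k (Hist.triv (F.P K) k) W)))) (anchors_nonempty (F := F) K b Y).choose c))
                    else 0)
                  BR (canonLegDist F) (hF ▸ 𝔠).b₀ p₁ a C_B)) :
    K1aLegRowsDisplayChiAtLowV4 L 𝔠 a₀ a₁ a p₁ := by
  obtain ⟨κ', ρ, C, C_A, C_B, γB, hκ', hρ, hC, hCA, hCB, hγB, hall⟩ := h
  have hB : 0 < 𝔠.B₃ := 𝔠.B₃_pos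
  have hδ : 0 < deltaSU (Fin 2) := deltaSU_pos
  have hp₁' : 0 < p₁ := by have := 𝔠.p₀_pos; have := 𝔠.one_le_r₀; linarith
  have hL7 : (0 : ℝ) < (((3 + 4) * L : ℕ) : ℝ) := by
    have h7 : 0 < (3 + 4) * L := by omega
    exact_mod_cast h7
  set σ : ℝ := min a₁ (min (a₀ / 𝔠.B₃) (min (1 / (3 * (143 * ((((3 + 4 : ℕ) : ℝ)) ^ 2 / 4) ^ 2) * 𝔠.B₃))
      (deltaSU (Fin 2) / ((((3 + 4) * L : ℕ) : ℝ) ^ 2 * 𝔠.B₃)))) with hσ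
  have hσpos : 0 < σ := by rw [hσ]; positivity
  refine ⟨κ', ρ, C, C_A, 24 * (L : ℝ) * 𝔠.B₃, C_B, min γB (gammaθ 𝔠.b₀ p₁ σ), hκ', hρ, hC, hCA, by positivity, hCB,
    lt_min hγB (gammaθ_pos 𝔠.b₀_pos hp₁' hσpos), fun F γ hF hγ hγle hγ1 => ?_⟩
  subst hF
  obtain ⟨Ψ, BR, hΨ, hBR, himp⟩ := hall F γ rfl hγ (hγle.trans (min_le_left _ _)) hγ1
  refine ⟨Ψ, BR, hΨ, hBR, fun hOf => ?_⟩
  obtain ⟨p, hp, Φ, e, hR1, hR2, hNΦe, hM1, hR5⟩ := himp hOf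
  have hθ : ∀ K n, n < K →
      θBal F.L γ 𝔠.b₀ p₁ n ≤ (p K).a₁ ∧ 𝔠.B₃ * θBal F.L γ 𝔠.b₀ p₁ n ≤ (p K).a₀ ∧
      (143 * ((((3 + 4 : ℕ) : ℝ)) ^ 2 / 4) ^ 2) * (𝔠.B₃ * θBal F.L γ 𝔠.b₀ p₁ n) ≤ 1 / 3 ∧
      2 * (𝔠.B₃ * θBal F.L γ 𝔠.b₀ p₁ n) ≤ 2 * deltaSU (Fin 2) / (((3 + 4) * F.L : ℕ) : ℝ) ^ 2 := fun K n _ => by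
    obtain ⟨h1, h2, h3, h4⟩ := windowLetters_of_le_gammaθ (𝔠 := 𝔠) hγ (hγ1.trans (sq_min_one_le _ 𝔠.gamma0_pos)) ha₀ ha₁ hp₁'
      (hγle.trans (min_le_right _ _)) n
    rw [(hp K).1, (hp K).2]
    exact ⟨h1, h2, h3, h4⟩
  refine ⟨p, hp, Φ, e,
    (fun K k b Y W c =>
        if h : b + 1 = k then birthCfgAtRows (fun K => (p K).toRows) K b Y (h ▸ W) c
        else if (l1 (rel (anchors_nonempty (F := F) K b Y).choose c.src) : ℝ) *
            (2 * (𝔠.B₃ * θBal F.L γ 𝔠.b₀ p₁ (K - k)) * (((F.L : ℝ) ^ (k - b))⁻¹) ^ 2) ≤ 1 / 2 then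
          (lieC (suGroupModel 2)).orthogonalProjectionOnto
            (vecE (suGroupModel 2).N
              (B27T (unitsField (toUField (Averaging.iter (fun i => BlockAveraging.blockAvg (P := F.P K) (j := i) ℰp) b
                ((p K).UkH k (Hist.triv (F.P K) k) W)))) (anchors_nonempty (F := F) K b Y).choose c))
        else 0), hR1, hR2, ?_, hM1, cfgDistOwnΦLow_naturalRows (fun K => (p K).toRows) hθ, hR5⟩
  intro K k hk X hX
  obtain ⟨hΦ, he⟩ := hNΦe K k hk X hX
  exact ⟨hΦ, he, fun W => naturalRows_newLevel_eq_bcfg (fun K => (p K).toRows) K k hk X hX W⟩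

/-! ## §3 The door display from print's (43) kernel row: (N) and (M1) traded for `hsep` and the kernel row at the natural chart family -/

open Classical in
/-- ★★ **THE v4 DOOR DISPLAY WITH (N) AND (M1) DISCHARGED AT THE NATURAL OBJECTS** `(Φ♮[birthChartRows q, N], 0, B♮ᴿ)` (`q = toRows ∘ p`): if, with constants `κ′ ρ C C_A C_B γB`, for
every `F` (`F.L = L`), `γ ≤ γB`, there are a height-free `Ψ` and a coherent `BR` such that every coherent v4 χ-package admits a LEG-INDEXED KERNEL FAMILY `N` with — PRINT'S (43)
KERNEL ROW («`oldTermRows q K k (1+j) y W = Re Σ_n (n!)⁻¹ Σ_c N K j y n c (B♮ᴿ ∘ c)`»), (R1)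
`KernelRefOwnΦ … Φ♮ Ψ …`, (R2′) `ChartAnalyticΦ … (rescaleΦw … Φ♮) …` and (R5) `CfgRefOwnΦ … B♮ᴿ BR …` — then, for big blocks bigger than one averaging block (`L < M₁`, print's «M₁ large»), `K1aLegRowsDisplayChiAtLowV4 L 𝔠 a₀ a₁ a p₁` for every `p₁ ≥ p₀ + r₀`
(`k1aLegRowsDisplayChiAtLowV4_of_naturalRows` at `Φ := Φ♮`, `e := 0`, with ✓`hsep_of_lt`, ✓`naturalChart_of_forall_ne` and ✓`oldTermsAreJetsOwnRows_natural_of_kernelRow`).  What remains displayed is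
print-shaped: two cross-cut-off rows (R1)/(R5) (UNPRINTED for non-abelian d = 3, E2 = NO) and the analyticity row (R2′), whose old-block clause is a leg-weighted kernel budget
(✓`chartAnalyticityAsCited_rescaleW_naturalChart_blockSet`). [cite: Balaban1985UV3, (27)-(28) p.263, (33)-(34) p.264, (43)-(45) pp.266-267, (59)-(61) pp.270-271; King1986, Prop. 3.6 (3.56) p.662, Prop. 3.9 (3.71)-(3.74) p.665] -/
theorem k1aLegRowsDisplayChiAtLowV4_of_kernelRows {L : ℕ} (hL : 1 < L) {𝔠 : AlphaConsts L (suGroupModel 2).N} (hM : L < 𝔠.M₁) {a₀ a₁ a p₁ : ℝ}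
    (ha₀ : 0 < a₀) (ha₁ : 0 < a₁) (hp₁ : 𝔠.p₀ + 𝔠.r₀ ≤ p₁)
    (h : ∃ (κ' ρ C C_A C_B γB : ℝ), 0 < κ' ∧ 0 < ρ ∧ 0 ≤ C ∧ 0 ≤ C_A ∧ 0 ≤ C_B ∧ 0 < γB ∧
      ∀ (F : T3Family) (γ : ℝ) (hF : F.L = L) (hγ : 0 < γ), γ ≤ γB → ∀ (hγ1 : γ ≤ (min (hF ▸ 𝔠).gamma0 1) ^ 2),
        ∃ (Ψ : ChartFam ↥(lieC (suGroupModel 2)) F) (BR : CfgFam ↥(lieC (suGroupModel 2)) F), KerHeightFree Ψ ∧ RefCfgCoherent BR ∧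
          (AlphaInputsT3AC.OfV4ChiAt F (hF ▸ 𝔠) a₀ a₁ →
            ∃ (p : ∀ K, AlphaInputsT3AC.PkgAtV4Chi F (hF ▸ 𝔠) γ hγ hγ1 K), (∀ K, (p K).a₀ = a₀ ∧ (p K).a₁ = a₁) ∧
              ∃ (N : (K b : ℕ) → Site (F.P K) (1 + b) → (n : ℕ) → (Fin n → PBond (F.P K) b) →
                  ContinuousMultilinearMap ℂ (fun _ : Fin n => ↥(lieC (suGroupModel 2))) ℂ),
                (∀ (K k : ℕ), k + 1 ≤ K → ∀ j : ℕ, j < k →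
                  ∀ y ∈ oldBlocks (hF ▸ 𝔠).lane.carrier.M₁ (rcolOf (SK F (hF ▸ 𝔠) γ hγ hγ1 K) (hF ▸ 𝔠).lane.carrier) (Hist.triv (F.P K) (k + 1)) (1 + j),
                    ∀ W : GaugeField (F.P K) (k + 1) (Matrix.specialUnitaryGroup (Fin 2) ℂ),
                      oldTermRows (fun K => (p K).toRows) K k (1 + j) y W =
                        (∑ n ∈ Finset.Ico 2 7, ((n ! : ℂ))⁻¹ * ∑ c : Fin n → PBond (F.P K) j, N K j y n c (fun i =>
                          (fun K k b Y W c =>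
                            if h : b + 1 = k then birthCfgAtRows (fun K => (p K).toRows) K b Y (h ▸ W) c
                            else if (l1 (rel (anchors_nonempty (F := F) K b Y).choose c.src) : ℝ) *
                                (2 * ((hF ▸ 𝔠).B₃ * θBal F.L γ (hF ▸ 𝔠).b₀ p₁ (K - k)) * (((F.L : ℝ) ^ (k - b))⁻¹) ^ 2) ≤ 1 / 2 then
                              (lieC (suGroupModel 2)).orthogonalProjectionOnto
                                (vecE (suGroupModel 2).N
                                  (B27T (unitsField (toUField (Averaging.iter (fun i => BlockAveraging.blockAvg (P := F.P K) (j := i) ℰp) b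
                                    ((p K).UkH k (Hist.triv (F.P K) k) W)))) (anchors_nonempty (F := F) K b Y).choose c))
                            else 0) K (k + 1) j (blockSet K (1 + j) y) W (c i))).re) ∧
                KernelRefOwnΦ (AlphaInputsT3AC.dataOfV4chi p (canonPolymerRows fun K => (p K).toRows))
                  (fun K b Y =>
                    if h : ∃ y : Site (F.P K) (1 + b), blockSet K (1 + b) y = Y then
                      (fun x : PBond (F.P K) b → ↥(lieC (suGroupModel 2)) =>
                        ∑ n ∈ Finset.Ico 2 7, ((n ! : ℂ))⁻¹ * ∑ c : Fin n → PBond (F.P K) b, N K b h.choose n c (fun i => x (c i)))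
                    else birthChartRows (fun K => (p K).toRows) K b Y)
                  Ψ (canonLegDist F) κ' (hF ▸ 𝔠).κ a C ∧
                ChartAnalyticΦ (AlphaInputsT3AC.dataOfV4chi p (canonPolymerRows fun K => (p K).toRows))
                  (rescaleΦw (canonLegDist F) κ' fun K b Y =>
                    if h : ∃ y : Site (F.P K) (1 + b), blockSet K (1 + b) y = Y then
                      (fun x : PBond (F.P K) b → ↥(lieC (suGroupModel 2)) =>
                        ∑ n ∈ Finset.Ico 2 7, ((n ! : ℂ))⁻¹ * ∑ c : Fin n → PBond (F.P K) b, N K b h.choose n c (fun i => x (c i)))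
                    else birthChartRows (fun K => (p K).toRows) K b Y) (hF ▸ 𝔠).κ ρ C_A ∧
                CfgRefOwnΦ (AlphaInputsT3AC.dataOfV4chi p (canonPolymerRows fun K => (p K).toRows))
                  (fun K k b Y W c =>
                    if h : b + 1 = k then birthCfgAtRows (fun K => (p K).toRows) K b Y (h ▸ W) c
                    else if (l1 (rel (anchors_nonempty (F := F) K b Y).choose c.src) : ℝ) *
                        (2 * ((hF ▸ 𝔠).B₃ * θBal F.L γ (hF ▸ 𝔠).b₀ p₁ (K - k)) * (((F.L : ℝ) ^ (k - b))⁻¹) ^ 2) ≤ 1 / 2 then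
                      (lieC (suGroupModel 2)).orthogonalProjectionOnto
                        (vecE (suGroupModel 2).N
                          (B27T (unitsField (toUField (Averaging.iter (fun i => BlockAveraging.blockAvg (P := F.P K) (j := i) ℰp) b
                            ((p K).UkH k (Hist.triv (F.P K) k) W)))) (anchors_nonempty (F := F) K b Y).choose c))
                    else 0)
                  BR (canonLegDist F) (hF ▸ 𝔠).b₀ p₁ a C_B)) :
    K1aLegRowsDisplayChiAtLowV4 L 𝔠 a₀ a₁ a p₁ := by
  obtain ⟨κ', ρ, C, C_A, C_B, γB, hκ', hρ, hC, hCA, hCB, hγB, hall⟩ := h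
  refine k1aLegRowsDisplayChiAtLowV4_of_naturalRows hL ha₀ ha₁ hp₁ ⟨κ', ρ, C, C_A, C_B, γB, hκ', hρ, hC, hCA, hCB, hγB, fun F γ hF hγ hγle hγ1 => ?_⟩
  obtain ⟨Ψ, BR, hΨ, hBR, himp⟩ := hall F γ hF hγ hγle hγ1
  refine ⟨Ψ, BR, hΨ, hBR, fun hOf => ?_⟩
  obtain ⟨p, hp, N, hK, hR1, hR2, hR5⟩ := himp hOf
  subst hF
  refine ⟨p, hp, _, fun _ _ _ => 0, hR1, hR2,
    fun K k hk X hX => ⟨naturalChart_of_forall_ne _ N (hsep_of_lt (fun K => (p K).toRows) hM K k hk X hX), rfl⟩,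
    oldTermsAreJetsOwnRows_natural_of_kernelRow (fun K => (p K).toRows) N hK, hR5⟩

end Summit.QuantumFields.YangMills.Theorems.GlobalSlackKernelLeg

end
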